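import Summits.Ventures.PercRepro.C041CSCount
import Summits.Ventures.PercRepro.C041ZoneOCubeUnion

/-!
# THE UNION LEMMA FOR (CS) — CONJECTURE (CS) is closed under independent OR-products (p6, gen 28; mine-3's
C-041.md §16 (ii))

Two independent components with counts `(N_i, v_i, x_i, y_i)` (states, valid, `Good₁`, `Good₂`) combine, for
`valid = ∨`, `G_t = ∨`, to `V = v₁N₂ + v₂N₁ − v₁v₂`, `X = x₁N₂ + x₂N₁ − x₁x₂`, `Y = y₁N₂ + y₂N₁ − y₁y₂`.  THE UNION
LEMMA FOR (CS): (CS) for both components gives (CS) for the product.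

PROOF (real, `union_cs_real`; the paper's argument made exact).  With the excesses `b_i := v_i − x_i − y_i`,
`s_i := x_i + y_i`, `r_i := √(x_iy_i)` (so `b_i ≤ r_i` by (CS)) the excess of the product is BILINEAR:
`b = b₁(N₂ − s₂) + b₂(N₁ − s₁) − b₁b₂ − x₁y₂ − y₁x₂`, with `∂b/∂b₁ = N₂ − v₂ ≥ 0`; so `b ≤ b|_{b₁ = r₁}`, and
then, according to the sign of `c := N₁ − s₁ − r₁`, either `b₂ ↦ r₂` (`c ≥ 0`) or `b₂ ↦ −s₂` (`c < 0`):
* `c < 0`: `b ≤ r₁N₂ − x₂(N₁ − x₁) − y₂(N₁ − y₁) ≤ r₁N₂` and `(r₁N₂)² = x₁y₁N₂² ≤ XY`;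
* `c ≥ 0`: `b ≤ r₁N₂ + r₂c`, `c ≤ t := √((N₁ − x₁)(N₁ − y₁))` because `(N₁ − x₁)(N₁ − y₁) − c² = (N₁ − s₁)(s₁ + 2r₁)
  ≥ 0`, and `(r₁N₂ + r₂t)² ≤ XY` is the two-term CAUCHY–SCHWARZ `2r₁r₂t ≤ x₁y₂(N₁ − y₁) + x₂y₁(N₁ − x₁)`
  (AM–GM, the product of the two terms being `(r₁r₂t)²`).

* **`cs_union`** — the counting form in `ℕ` (`CSCount.CS`), for `x_i, y_i ≤ v_i ≤ N_i`;
* **`union_lemma_cs`** — the component form on `S₁ × S₂` with the indicator sums of `C041ZoneOCubeUnion`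
  (`ind`, `sum_prod_ind_or`): (CS) for two components (the `G`'s implying validity) gives (CS) for their product,
  stated as `(max (V − X − Y) 0)² ≤ X·Y` in `ℤ`.
Hence, exactly as in C-041.md §14 (c) for the O-cube, the ZONE (CS) for every terminal-adjacent zone of a hub core
gives (CS) — and so (O-CUBE) — for the whole; the gluing through `cubeEquiv` is the same as in
`C041ZoneOCubeHubSum` and is not repeated here.
-/

namespace PercRepro

namespace CSCount

open Real

/-- AM–GM in the form `2r ≤ a + b` when `r² = ab`, `r ≥ 0`. -/
theorem two_mul_le_add_of_sq_eq {a b r : ℝ} (ha : 0 ≤ a) (hb : 0 ≤ b) (hr : 0 ≤ r) (h : r ^ 2 = a * b) :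
    2 * r ≤ a + b := by
  have h1 : (2 * r) ^ 2 ≤ (a + b) ^ 2 := by nlinarith [sq_nonneg (a - b)]
  exact (pow_le_pow_iff_left₀ (by positivity) (by positivity) two_ne_zero).1 h1

/-- A nonnegative real whose square is at most `z` is at most `√z`. -/
theorem le_sqrt_of_sq_le {c z : ℝ} (hc : 0 ≤ c) (h : c ^ 2 ≤ z) : c ≤ Real.sqrt z :=
  (Real.le_sqrt hc (le_trans (sq_nonneg c) h)).2 h

/-- **THE UNION LEMMA FOR (CS), real form**: two components with `0 ≤ x_i, y_i ≤ v_i ≤ N_i` satisfying (CS) give (CS)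
for their OR-product. -/
theorem union_cs_real {N₁ v₁ x₁ y₁ N₂ v₂ x₂ y₂ : ℝ}
    (hx₁ : 0 ≤ x₁) (hy₁ : 0 ≤ y₁) (hx₁v : x₁ ≤ v₁) (hy₁v : y₁ ≤ v₁) (hv₁ : v₁ ≤ N₁)
    (hx₂ : 0 ≤ x₂) (hy₂ : 0 ≤ y₂) (hx₂v : x₂ ≤ v₂) (hy₂v : y₂ ≤ v₂) (hv₂ : v₂ ≤ N₂)
    (h₁ : (max (v₁ - x₁ - y₁) 0) ^ 2 ≤ x₁ * y₁) (h₂ : (max (v₂ - x₂ - y₂) 0) ^ 2 ≤ x₂ * y₂) :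
    (max ((v₁ * N₂ + v₂ * N₁ - v₁ * v₂) - (x₁ * N₂ + x₂ * N₁ - x₁ * x₂) - (y₁ * N₂ + y₂ * N₁ - y₁ * y₂)) 0) ^ 2
      ≤ (x₁ * N₂ + x₂ * N₁ - x₁ * x₂) * (y₁ * N₂ + y₂ * N₁ - y₁ * y₂) := by
  -- the square roots
  set r₁ := Real.sqrt (x₁ * y₁) with hr₁
  set r₂ := Real.sqrt (x₂ * y₂) with hr₂
  have hr₁0 : 0 ≤ r₁ := Real.sqrt_nonneg _
  have hr₂0 : 0 ≤ r₂ := Real.sqrt_nonneg _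
  have hr₁sq : r₁ ^ 2 = x₁ * y₁ := Real.sq_sqrt (mul_nonneg hx₁ hy₁)
  have hr₂sq : r₂ ^ 2 = x₂ * y₂ := Real.sq_sqrt (mul_nonneg hx₂ hy₂)
  have hb₁ : v₁ - x₁ - y₁ ≤ r₁ :=
    le_trans (le_max_left _ _) (le_sqrt_of_sq_le (le_max_right _ _) h₁)
  have hb₂ : v₂ - x₂ - y₂ ≤ r₂ :=
    le_trans (le_max_left _ _) (le_sqrt_of_sq_le (le_max_right _ _) h₂)
  have hN₁x : x₁ ≤ N₁ := le_trans hx₁v hv₁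
  have hN₁y : y₁ ≤ N₁ := le_trans hy₁v hv₁
  have hN₂x : x₂ ≤ N₂ := le_trans hx₂v hv₂
  have hN₂y : y₂ ≤ N₂ := le_trans hy₂v hv₂
  have hN₂0 : 0 ≤ N₂ := le_trans hx₂ hN₂x
  -- the product counts
  set X := x₁ * N₂ + x₂ * N₁ - x₁ * x₂ with hX
  set Y := y₁ * N₂ + y₂ * N₁ - y₁ * y₂ with hY
  have hXY : X * Y = x₁ * y₁ * N₂ ^ 2 + N₂ * (x₁ * y₂ * (N₁ - y₁) + x₂ * y₁ * (N₁ - x₁)) +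
      x₂ * y₂ * ((N₁ - x₁) * (N₁ - y₁)) := by
    rw [hX, hY]
    ring
  have hα : 0 ≤ x₁ * y₂ * (N₁ - y₁) := mul_nonneg (mul_nonneg hx₁ hy₂) (by linarith)
  have hβ : 0 ≤ x₂ * y₁ * (N₁ - x₁) := mul_nonneg (mul_nonneg hx₂ hy₁) (by linarith)
  have hγ : 0 ≤ x₂ * y₂ * ((N₁ - x₁) * (N₁ - y₁)) :=
    mul_nonneg (mul_nonneg hx₂ hy₂) (mul_nonneg (by linarith) (by linarith))
  have hXY₀ : x₁ * y₁ * N₂ ^ 2 ≤ X * Y := by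
    rw [hXY]
    have := mul_nonneg hN₂0 (add_nonneg hα hβ)
    linarith
  -- the excess is bilinear in the two excesses; step A: raise `b₁` to `r₁`
  set b := (v₁ * N₂ + v₂ * N₁ - v₁ * v₂) - X - Y with hb
  have hbil : b = (v₁ - x₁ - y₁) * (N₂ - (x₂ + y₂)) + (v₂ - x₂ - y₂) * (N₁ - (x₁ + y₁)) -
      (v₁ - x₁ - y₁) * (v₂ - x₂ - y₂) - x₁ * y₂ - y₁ * x₂ := by
    rw [hb, hX, hY]
    ring
  have hA : b ≤ r₁ * (N₂ - (x₂ + y₂)) + (v₂ - x₂ - y₂) * (N₁ - (x₁ + y₁) - r₁) - x₁ * y₂ - y₁ * x₂ := by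
    rw [hbil]
    have : ((v₁ - x₁ - y₁) - r₁) * (N₂ - v₂) ≤ 0 :=
      mul_nonpos_of_nonpos_of_nonneg (by linarith) (by linarith)
    linarith [this]
  -- step B: the sign of `c = N₁ − s₁ − r₁`
  by_cases hc : 0 ≤ N₁ - (x₁ + y₁) - r₁
  · -- raise `b₂` to `r₂`, then Cauchy–Schwarz
    set c := N₁ - (x₁ + y₁) - r₁ with hcdef
    set t := Real.sqrt ((N₁ - x₁) * (N₁ - y₁)) with ht
    have ht0 : 0 ≤ t := Real.sqrt_nonneg _
    have htsq : t ^ 2 = (N₁ - x₁) * (N₁ - y₁) := Real.sq_sqrt (mul_nonneg (by linarith) (by linarith))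
    have hct : c ≤ t := by
      apply le_sqrt_of_sq_le hc
      have hs : x₁ + y₁ ≤ N₁ := by linarith
      have key : (N₁ - x₁) * (N₁ - y₁) - c ^ 2 = (N₁ - (x₁ + y₁)) * ((x₁ + y₁) + 2 * r₁) := by
        rw [hcdef]
        linear_combination (-1 : ℝ) * hr₁sq
      have h0 : 0 ≤ (N₁ - (x₁ + y₁)) * ((x₁ + y₁) + 2 * r₁) :=
        mul_nonneg (sub_nonneg.2 hs) (add_nonneg (add_nonneg hx₁ hy₁) (mul_nonneg (by norm_num) hr₁0))
      linarith [key, h0]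
    have hB : b ≤ r₁ * N₂ + r₂ * t := by
      have e1 : (v₂ - x₂ - y₂) * c ≤ r₂ * c := mul_le_mul_of_nonneg_right hb₂ hc
      have e2 : r₂ * c ≤ r₂ * t := mul_le_mul_of_nonneg_left hct hr₂0
      have e3 : 0 ≤ r₁ * (x₂ + y₂) := mul_nonneg hr₁0 (add_nonneg hx₂ hy₂)
      have e4 : 0 ≤ x₁ * y₂ := mul_nonneg hx₁ hy₂
      have e5 : 0 ≤ y₁ * x₂ := mul_nonneg hy₁ hx₂
      linarith [hA, e1, e2, e3, e4, e5]
    -- `(r₁N₂ + r₂t)² ≤ XY`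
    have hcross : 2 * (r₁ * r₂ * t) ≤ x₁ * y₂ * (N₁ - y₁) + x₂ * y₁ * (N₁ - x₁) := by
      apply two_mul_le_add_of_sq_eq hα hβ (mul_nonneg (mul_nonneg hr₁0 hr₂0) ht0)
      calc (r₁ * r₂ * t) ^ 2 = r₁ ^ 2 * r₂ ^ 2 * t ^ 2 := by ring
        _ = (x₁ * y₁) * (x₂ * y₂) * ((N₁ - x₁) * (N₁ - y₁)) := by rw [hr₁sq, hr₂sq, htsq]
        _ = x₁ * y₂ * (N₁ - y₁) * (x₂ * y₁ * (N₁ - x₁)) := by ring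
    have hsq : (r₁ * N₂ + r₂ * t) ^ 2 ≤ X * Y := by
      rw [hXY]
      have e : (r₁ * N₂ + r₂ * t) ^ 2 = r₁ ^ 2 * N₂ ^ 2 + N₂ * (2 * (r₁ * r₂ * t)) + r₂ ^ 2 * t ^ 2 := by ring
      rw [e, hr₁sq, hr₂sq, htsq]
      have := mul_le_mul_of_nonneg_left hcross hN₂0
      linarith
    have hmax : max b 0 ≤ r₁ * N₂ + r₂ * t :=
      max_le hB (add_nonneg (mul_nonneg hr₁0 hN₂0) (mul_nonneg hr₂0 ht0))
    calc (max b 0) ^ 2 ≤ (r₁ * N₂ + r₂ * t) ^ 2 := pow_le_pow_left₀ (le_max_right _ _) hmax 2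
      _ ≤ X * Y := hsq
  · -- lower `b₂` to `−s₂`
    push Not at hc
    have hB : b ≤ r₁ * N₂ := by
      have e1 : (v₂ - x₂ - y₂) * (N₁ - (x₁ + y₁) - r₁) ≤ (-(x₂ + y₂)) * (N₁ - (x₁ + y₁) - r₁) :=
        mul_le_mul_of_nonpos_right (by linarith) (le_of_lt hc)
      have e2 : 0 ≤ x₂ * (N₁ - x₁) := mul_nonneg hx₂ (by linarith)
      have e3 : 0 ≤ y₂ * (N₁ - y₁) := mul_nonneg hy₂ (by linarith)
      linarith [hA, e1, e2, e3]
    have hmax : max b 0 ≤ r₁ * N₂ := max_le hB (mul_nonneg hr₁0 hN₂0)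
    calc (max b 0) ^ 2 ≤ (r₁ * N₂) ^ 2 := pow_le_pow_left₀ (le_max_right _ _) hmax 2
      _ = x₁ * y₁ * N₂ ^ 2 := by rw [mul_pow, hr₁sq]
      _ ≤ X * Y := hXY₀

/-- The truncated subtraction of `ℕ`, cast to `ℝ`, is the positive part. -/
theorem cast_tsub_tsub_eq_max (v x y : ℕ) : ((v - x - y : ℕ) : ℝ) = max ((v : ℝ) - x - y) 0 := by
  by_cases h : v ≤ x + y
  · have e : v - x - y = 0 := by omega
    rw [e, Nat.cast_zero]
    have : (v : ℝ) - x - y ≤ 0 := by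
      have := (Nat.cast_le (α := ℝ)).2 h
      push_cast at this
      linarith
    rw [max_eq_right this]
  · push Not at h
    have hx : x ≤ v := by omega
    have hy : y ≤ v - x := by omega
    rw [Nat.cast_sub hy, Nat.cast_sub hx]
    have : 0 ≤ (v : ℝ) - x - y := by
      have := (Nat.cast_lt (α := ℝ)).2 h
      push_cast at this
      linarith
    rw [max_eq_left this]

/-- (CS) in `ℕ` is the real positive-part form. -/
theorem cs_iff_real (v x y : ℕ) : CS v x y ↔ (max ((v : ℝ) - x - y) 0) ^ 2 ≤ x * y := by
  unfold CS
  rw [← cast_tsub_tsub_eq_max]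
  exact ⟨fun h => by exact_mod_cast h, fun h => by exact_mod_cast h⟩

/-- **THE UNION LEMMA FOR (CS), counting form**: two components with `x_i, y_i ≤ v_i ≤ N_i` satisfying (CS) give (CS)
for their OR-product `(v₁N₂ + v₂N₁ − v₁v₂, x₁N₂ + x₂N₁ − x₁x₂, y₁N₂ + y₂N₁ − y₁y₂)`. -/
theorem cs_union {N₁ v₁ x₁ y₁ N₂ v₂ x₂ y₂ : ℕ} (hx₁v : x₁ ≤ v₁) (hy₁v : y₁ ≤ v₁) (hv₁ : v₁ ≤ N₁)
    (hx₂v : x₂ ≤ v₂) (hy₂v : y₂ ≤ v₂) (hv₂ : v₂ ≤ N₂) (h₁ : CS v₁ x₁ y₁) (h₂ : CS v₂ x₂ y₂) :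
    CS (v₁ * N₂ + v₂ * N₁ - v₁ * v₂) (x₁ * N₂ + x₂ * N₁ - x₁ * x₂) (y₁ * N₂ + y₂ * N₁ - y₁ * y₂) := by
  rw [cs_iff_real] at h₁ h₂ ⊢
  have e1 : v₁ * v₂ ≤ v₁ * N₂ + v₂ * N₁ := le_trans (Nat.mul_le_mul_left v₁ hv₂) (Nat.le_add_right _ _)
  have e2 : x₁ * x₂ ≤ x₁ * N₂ + x₂ * N₁ :=
    le_trans (Nat.mul_le_mul_left x₁ (le_trans hx₂v hv₂)) (Nat.le_add_right _ _)
  have e3 : y₁ * y₂ ≤ y₁ * N₂ + y₂ * N₁ :=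
    le_trans (Nat.mul_le_mul_left y₁ (le_trans hy₂v hv₂)) (Nat.le_add_right _ _)
  rw [Nat.cast_sub e1, Nat.cast_sub e2, Nat.cast_sub e3]
  push_cast
  exact union_cs_real (Nat.cast_nonneg x₁) (Nat.cast_nonneg y₁) (by exact_mod_cast hx₁v) (by exact_mod_cast hy₁v)
    (by exact_mod_cast hv₁) (Nat.cast_nonneg x₂) (Nat.cast_nonneg y₂) (by exact_mod_cast hx₂v)
    (by exact_mod_cast hy₂v) (by exact_mod_cast hv₂) h₁ h₂

end CSCount

namespace ZoneOCube

open Finset CSCount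

section Product

variable {S₁ S₂ : Type*} [Fintype S₁] [Fintype S₂]

/-- **THE UNION LEMMA FOR (CS), component form** (C-041.md §16 (ii)): two independent components whose indicator
sums satisfy (CS) (the `G`'s implying validity) have a product satisfying (CS), for `valid = ∨`, `g_t = ∨`. -/
theorem union_lemma_cs {v₁ g₁ h₁ : S₁ → Prop} {v₂ g₂ h₂ : S₂ → Prop}
    (hg₁ : ∀ σ, g₁ σ → v₁ σ) (hh₁ : ∀ σ, h₁ σ → v₁ σ) (hg₂ : ∀ τ, g₂ τ → v₂ τ) (hh₂ : ∀ τ, h₂ τ → v₂ τ)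
    (H₁ : (max ((∑ σ, ind (v₁ σ)) - (∑ σ, ind (g₁ σ)) - (∑ σ, ind (h₁ σ))) 0) ^ 2 ≤
      (∑ σ, ind (g₁ σ)) * (∑ σ, ind (h₁ σ)))
    (H₂ : (max ((∑ τ, ind (v₂ τ)) - (∑ τ, ind (g₂ τ)) - (∑ τ, ind (h₂ τ))) 0) ^ 2 ≤
      (∑ τ, ind (g₂ τ)) * (∑ τ, ind (h₂ τ))) :
    (max ((∑ x : S₁ × S₂, ind (v₁ x.1 ∨ v₂ x.2)) - (∑ x : S₁ × S₂, ind (g₁ x.1 ∨ g₂ x.2)) -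
      (∑ x : S₁ × S₂, ind (h₁ x.1 ∨ h₂ x.2))) 0) ^ 2 ≤
      (∑ x : S₁ × S₂, ind (g₁ x.1 ∨ g₂ x.2)) * (∑ x : S₁ × S₂, ind (h₁ x.1 ∨ h₂ x.2)) := by
  rw [sum_prod_ind_or, sum_prod_ind_or, sum_prod_ind_or]
  set N₁ : ℤ := (Fintype.card S₁ : ℤ)
  set N₂ : ℤ := (Fintype.card S₂ : ℤ)
  set X₁ := ∑ σ, ind (g₁ σ)
  set Y₁ := ∑ σ, ind (h₁ σ)
  set W₁ := ∑ σ, ind (v₁ σ)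
  set X₂ := ∑ τ, ind (g₂ τ)
  set Y₂ := ∑ τ, ind (h₂ τ)
  set W₂ := ∑ τ, ind (v₂ τ)
  have hX₁ : X₁ ≤ W₁ := sum_ind_le_sum_ind hg₁
  have hY₁ : Y₁ ≤ W₁ := sum_ind_le_sum_ind hh₁
  have hX₂ : X₂ ≤ W₂ := sum_ind_le_sum_ind hg₂
  have hY₂ : Y₂ ≤ W₂ := sum_ind_le_sum_ind hh₂
  have hW₁ : W₁ ≤ N₁ := sum_ind_le_card v₁
  have hW₂ : W₂ ≤ N₂ := sum_ind_le_card v₂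
  have hX₁0 : 0 ≤ X₁ := sum_ind_nonneg g₁
  have hY₁0 : 0 ≤ Y₁ := sum_ind_nonneg h₁
  have hX₂0 : 0 ≤ X₂ := sum_ind_nonneg g₂
  have hY₂0 : 0 ≤ Y₂ := sum_ind_nonneg h₂
  -- to the real form
  have key := union_cs_real (N₁ := N₁) (v₁ := W₁) (x₁ := X₁) (y₁ := Y₁) (N₂ := N₂) (v₂ := W₂) (x₂ := X₂)
    (y₂ := Y₂) (by exact_mod_cast hX₁0) (by exact_mod_cast hY₁0) (by exact_mod_cast hX₁)
    (by exact_mod_cast hY₁) (by exact_mod_cast hW₁) (by exact_mod_cast hX₂0) (by exact_mod_cast hY₂0)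
    (by exact_mod_cast hX₂) (by exact_mod_cast hY₂) (by exact_mod_cast hW₂) (by exact_mod_cast H₁)
    (by exact_mod_cast H₂)
  have e1 : N₂ * W₁ + N₁ * W₂ - W₁ * W₂ = W₁ * N₂ + W₂ * N₁ - W₁ * W₂ := by ring
  have e2 : N₂ * X₁ + N₁ * X₂ - X₁ * X₂ = X₁ * N₂ + X₂ * N₁ - X₁ * X₂ := by ring
  have e3 : N₂ * Y₁ + N₁ * Y₂ - Y₁ * Y₂ = Y₁ * N₂ + Y₂ * N₁ - Y₁ * Y₂ := by ring
  rw [e1, e2, e3]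
  exact_mod_cast key

end Product

end ZoneOCube

end PercRepro
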